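import Literature.Analysis.FluidPDE.AxisymmetricEuler
import Literature.Analysis.FluidPDE.SelfSimilar
import HarnessLib

/-!
# Sectional circulation through meridional half-annuli

Topic `Literature/Analysis/FluidPDE` (definition file; requested by route
`NavierStokesRegularity/QuarterTurnRdss` for its informal crux `CirculationLedgerFunnel`).
Physical space is `ℝ³ = EuclideanSpace ℝ (Fin 3)`; the symmetry axis is the `x₂`-axis, as for
`rotZ`, `IsAxisymmetric` (`AxisymmetricEuler.lean`) and for the route's quarter-turn
`(Rx)₀ = −x₁, (Rx)₁ = x₀, (Rx)₂ = x₂`.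

For an angle `θ` let `H_θ = {(r cos θ, r sin θ, z) : r ≥ 0}` be the closed meridional half-plane
bounded by the axis, with in-plane frame `e_r(θ) = (cos θ, sin θ, 0)`, `e_z = (0, 0, 1)` and unit
normal `n_θ = e_θ(θ) = (−sin θ, cos θ, 0)` (`e_z × e_r = e_θ`). For radii `a ≤ b` the meridional
half-annulus `A(θ, a, b) = {y ∈ H_θ : a ≤ |y| ≤ b}` is, in the polar coordinates
`y = ρ (cos φ · e_z + sin φ · e_r(θ))` of `H_θ` (`φ ∈ [0, π]` measured from the positive axis),
the image of the box `[a, b] × [0, π]`.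

* `meridionalPoint θ r z = (r cos θ, r sin θ, z)`, `axialPoint z = (0, 0, z)`;
* `meridionalArcIntegral v θ ρ`: the line integral `∫ v · dl` along the meridional semicircle of
  radius `ρ` in `H_θ`, from the north pole `(0,0,ρ)` through `r > 0` to the south pole `(0,0,−ρ)`;
* `axialSegmentIntegral v s t = ∫ₛᵗ v₂(0, 0, z) dz`, the line integral along the axis from
  `(0,0,s)` to `(0,0,t)`;
* `sectionalCirculation v θ a b`: the **sectional circulation**, the circulation `∮ v · dl`
  around `∂A(θ, a, b)` oriented by the normal `n_θ`, i.e. (picture for `0 < a < b`) the loop: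
  outer semicircle `(0,0,b) → (0,0,−b)` through `r > 0`, axis `(0,0,−b) → (0,0,−a)`, inner
  semicircle backwards `(0,0,−a) → (0,0,a)`, axis `(0,0,a) → (0,0,b)` — literally a sum of four
  interval integrals (`sectionalCirculation_eq`). Total in `θ a b : ℝ` and in `v` (interval
  integrals are oriented and return `0` for non-integrable integrands); `v` is evaluated on the
  loop only, which for `0 < a ≤ b` keeps distance `a` from the origin, so fields continuous on
  `ℝ³ ∖ {0}` (Type-I profiles) are covered.

For `C¹` fields Green's formula on the polar box gives
`sectionalCirculation v θ a b = ∫ₐᵇ ∫₀^π ⟪curl v, e_θ⟫ ρ dφ dρ = ∫_{A(θ,a,b)} ω_θ dA`, the flux of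
the vorticity through the half-annulus in the direction `n_θ` (Kelvin–Stokes; Majda–Bertozzi
2002, (1.57), (1.61)). This motivates the orientation; it is NOT part of the definition and is
not proved here.

## Why bounded planar sections (design notes recorded from the request)

The quantity books the circulation carried by one "generation" (dyadic shell
`c^{-(n+1)} ≤ |y| ≤ c^{-n}`) of a rotated discretely self-similar (RDSS) profile —
Bradshaw–Tsai 2017, §1, (v0-RDSS): `v₀(x) = λ R(−φ) v₀(λ R(φ) x)`, `R(s)` the rotation by `s`
about the axis (`rotZ s`), here with the resonant phase `φ = π/2` — the way the
iterated-instability cascade books circulation per generation, `Γₙ₊₁ = C Γₙ bₙ/aₙ`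
(Brenner–Hormoz–Pumir 2016, §VI, eq. (19); McKeown et al. 2020). Two pitfalls force bounded
planar sections: the flux through a full meridional half-plane diverges logarithmically for
Type-I fields (`|curl v| ~ |x|⁻²`), and the supremum of `∮ v · dl` over all closed loops is `+∞`
by multi-winding around linked vortex lines.

## Main statements (all proved)

* `sectionalCirculation_conj_rotZ`: rotation covariance
  `S (R₋α ∘ v ∘ R_α) θ a b = S v (θ + α) a b` for `R_α = rotZ α`; the coordinate-pinned
  quarter-turn form `sectionalCirculation_quarterTurn` (`S (R⁻¹ ∘ v ∘ R) θ = S v (θ + π/2)`);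
  `IsAxisymmetric.sectionalCirculation_eq` (independence of `θ` for axisymmetric fields);
* `sectionalCirculation_nsRescaleData`: scaling covariance `S (x ↦ c v(cx)) θ a b = S v θ ca cb`
  for every `c : ℝ` — circulation is dimensionless under the Navier–Stokes scaling;
* `sectionalCirculation_of_rdssHomogeneous`, `sectionalCirculation_rdss_generation`: for a
  `(c, R)`-RDSS-homogeneous datum `u₀ = c R⁻¹ u₀(c R ·)`, `R` the quarter-turn,
  `S u₀ θ a b = S u₀ (θ + π/2) (ca) (cb)`; hence the generation ledger
  `Γ(θ, n) := S u₀ θ c^{-(n+1)} c^{-n}` (`n : ℤ`) obeys `Γ(θ, n + 1) = Γ(θ + π/2, n)`;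
* `sectionalCirculation_add` (additivity in the radii: consecutive shells telescope),
  `sectionalCirculation_self`, `sectionalCirculation_symm`, `sectionalCirculation_add_two_pi`.

## Orientation convention

The loop is oriented by `n_θ = (−sin θ, cos θ, 0)`: counter-clockwise in the oriented frame
`(e_z, e_r)` of `H_θ`, so the polar angle `φ` increases along the outer arc; drawn with `r` to
the right and `z` upwards it runs clockwise. The enumeration "outer semicircle from `z = −b` to
`z = b`, axis `(0,0,b) → (0,0,a)`, inner semicircle backwards, axis `(0,0,−a) → (0,0,−b)`" is the
REVERSED loop (normal `−n_θ`) and gives `−sectionalCirculation v θ a b`. Check: `v = (x₂, 0, −x₀)`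
has `curl v = 2e₁ = 2n_0` and `sectionalCirculation v 0 a b = π(b² − a²)` (verified in a scratch
file). All covariance identities are insensitive to this choice.

## Mathlib / tree search

Mathlib (this pin) has curve integrals of `1`-forms (`Mathlib.MeasureTheory.Integral.CurveIntegral`)
but no circulation or flux bookkeeping; the tree has the whole-loop `circulation v γ`
(`Vorticity.lean`) and edge-by-edge polygon circulations (`PolygonCirculation.lean`). As in the
latter, the pieces are plain interval integrals with the velocity vectors written out, so no
differentiability of parametrisations is ever invoked. Used:
`intervalIntegral.smul_integral_comp_mul_left`, `intervalIntegral.integral_add_adjacent_intervals`;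
tree: `rotZ`, `IsAxisymmetric`, `nsRescaleData`, `IsRotatedDSS`.

## References

* Z. Bradshaw, T.-P. Tsai, *Rotationally corrected scaling invariant solutions to the
  Navier–Stokes equations*, Comm. PDE 42 (2017), §1: the rotations `R(s)`, (v-RDSS), (v0-RDSS),
  "if `nφ = 2πm` then `v` is DSS with factor `λⁿ`". [BradshawTsai2017CPDE]
* M. P. Brenner, S. Hormoz, A. Pumir, *Potential singularity mechanism for the Euler equations*,
  Phys. Rev. Fluids 1 (2016) 084503, §VI, eq. (19). [BrennerHormozPumir2016]
* R. McKeown et al., *Turbulence generation through an iterative cascade of the elliptical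
  instability*, Sci. Adv. 6 (2020). [MckeownEtAl2020]
* A. J. Majda, A. L. Bertozzi, *Vorticity and Incompressible Flow* (CUP 2002), Prop. 1.11, (1.57),
  (1.61). [MajdaBertozziCUP2002]
-/

noncomputable section

open MeasureTheory Set intervalIntegral WithLp
open scoped InnerProductSpace RealInnerProductSpace Real

namespace Literature.Analysis.FluidPDE

/-- Local notation for physical space `ℝ³ = EuclideanSpace ℝ (Fin 3)`. -/
local notation "ℝ³" => EuclideanSpace ℝ (Fin 3)

/-! ### Cylindrical coordinates: meridional half-planes and the axis -/

/-- The point with cylindrical coordinates `(r, θ, z)`: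
`meridionalPoint θ r z = (r cos θ, r sin θ, z)`. For fixed `θ` and `r ≥ 0` these points sweep
the closed meridional half-plane `H_θ` bounded by the `x₂`-axis; `(r, z) ↦ meridionalPoint θ r z`
is a linear isometric embedding of the plane (`inner_meridionalPoint`, `smul_meridionalPoint`),
turned about the axis by `rotZ` (`rotZ_meridionalPoint`). [folklore] -/
def meridionalPoint (θ r z : ℝ) : ℝ³ :=
  toLp 2 ![r * Real.cos θ, r * Real.sin θ, z]

/-- The point `(0, 0, z)` of the symmetry axis (the `x₂`-axis, fixed by every `rotZ θ`).
[folklore] -/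
def axialPoint (z : ℝ) : ℝ³ :=
  toLp 2 ![0, 0, z]

/-- First coordinate `(r cos θ, r sin θ, z)₀ = r cos θ`. [folklore] -/
@[simp] theorem meridionalPoint_apply_zero (θ r z : ℝ) :
    meridionalPoint θ r z 0 = r * Real.cos θ := rfl

/-- Second coordinate `(r cos θ, r sin θ, z)₁ = r sin θ`. [folklore] -/
@[simp] theorem meridionalPoint_apply_one (θ r z : ℝ) :
    meridionalPoint θ r z 1 = r * Real.sin θ := rfl

/-- Third (axial) coordinate `(r cos θ, r sin θ, z)₂ = z`. [folklore] -/
@[simp] theorem meridionalPoint_apply_two (θ r z : ℝ) : meridionalPoint θ r z 2 = z := rfl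

/-- `(0, 0, z)₀ = 0`. [folklore] -/
@[simp] theorem axialPoint_apply_zero (z : ℝ) : axialPoint z 0 = 0 := rfl

/-- `(0, 0, z)₁ = 0`. [folklore] -/
@[simp] theorem axialPoint_apply_one (z : ℝ) : axialPoint z 1 = 0 := rfl

/-- `(0, 0, z)₂ = z`. [folklore] -/
@[simp] theorem axialPoint_apply_two (z : ℝ) : axialPoint z 2 = z := rfl

/-- On the axis (`r = 0`) the meridional coordinates of all half-planes agree:
`meridionalPoint θ 0 z = (0, 0, z)`. [folklore] -/
theorem meridionalPoint_zero_left (θ z : ℝ) : meridionalPoint θ 0 z = axialPoint z := by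
  ext i
  fin_cases i <;> simp

/-- The meridional coordinates are isometric: `⟪(r, z), (r', z')⟫ = r r' + z z'`. [folklore] -/
theorem inner_meridionalPoint (θ r z r' z' : ℝ) :
    ⟪meridionalPoint θ r z, meridionalPoint θ r' z'⟫ = r * r' + z * z' := by
  simp only [PiLp.inner_apply, RCLike.inner_apply, conj_trivial, Fin.sum_univ_three,
    meridionalPoint_apply_zero, meridionalPoint_apply_one, meridionalPoint_apply_two]
  linear_combination (r * r') * Real.sin_sq_add_cos_sq θ

/-- The meridional coordinates are linear: `c • (r cos θ, r sin θ, z) = (cr cos θ, cr sin θ, cz)`.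
[folklore] -/
theorem smul_meridionalPoint (c θ r z : ℝ) :
    c • meridionalPoint θ r z = meridionalPoint θ (c * r) (c * z) := by
  ext i
  fin_cases i <;> simp [mul_assoc]

/-- `c • (0, 0, z) = (0, 0, cz)`. [folklore] -/
theorem smul_axialPoint (c z : ℝ) : c • axialPoint z = axialPoint (c * z) := by
  ext i
  fin_cases i <;> simp

/-- `(0, 0, z) ≠ 0` for `z ≠ 0`: the loops avoid the origin when `0 < a ≤ b`. [folklore] -/
theorem axialPoint_ne_zero {z : ℝ} (hz : z ≠ 0) : axialPoint z ≠ 0 := fun h =>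
  hz (by simpa using congrArg (fun p : ℝ³ => p 2) h)

/-- `z ↦ (0, 0, z)` is continuous (it is `z ↦ z • (0, 0, 1)`). [folklore] -/
theorem continuous_axialPoint : Continuous axialPoint := by
  have h : axialPoint = fun z => z • axialPoint 1 :=
    funext fun z => by rw [smul_axialPoint, mul_one]
  rw [h]
  fun_prop

/-- The rotation by `α` about the axis turns the half-plane `H_θ` onto `H_{θ+α}`:
`rotZ α (r cos θ, r sin θ, z) = (r cos (θ + α), r sin (θ + α), z)` (Bradshaw–Tsai 2017, §1,
the rotations `R(s)`). [cite: BradshawTsai2017CPDE, §1] -/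
theorem rotZ_meridionalPoint (α θ r z : ℝ) :
    rotZ α (meridionalPoint θ r z) = meridionalPoint (θ + α) r z := by
  ext i
  fin_cases i
  · simp [Real.cos_add]
    ring
  · simp [Real.sin_add]
    ring
  · simp

/-- Rotations about the axis fix the axis pointwise. [folklore] -/
theorem rotZ_axialPoint (α z : ℝ) : rotZ α (axialPoint z) = axialPoint z := by
  ext i
  fin_cases i <;> simp

/-- `rotZ (−α)` is the adjoint (= inverse) of the isometry `rotZ α`:
`⟪rotZ (−α) x, y⟫ = ⟪x, rotZ α y⟫`. [folklore] -/
theorem inner_rotZ_neg_left (α : ℝ) (x y : ℝ³) : ⟪rotZ (-α) x, y⟫ = ⟪x, rotZ α y⟫ := by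
  simp only [PiLp.inner_apply, RCLike.inner_apply, conj_trivial, Fin.sum_univ_three,
    rotZ_apply_zero, rotZ_apply_one, rotZ_apply_two, Real.cos_neg, Real.sin_neg]
  ring

/-- The meridional coordinates are `2π`-periodic in the angle. [folklore] -/
theorem meridionalPoint_add_two_pi (θ r z : ℝ) :
    meridionalPoint (θ + 2 * π) r z = meridionalPoint θ r z := by
  ext i
  fin_cases i <;> simp [Real.cos_add_two_pi, Real.sin_add_two_pi]

/-! ### Line integrals along meridional semicircles and along the axis -/

/-- The line integral `∫ v · dl` of `v : ℝ³ → ℝ³` along the **meridional semicircle** of radius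
`ρ` in the half-plane `H_θ`, parametrised by the polar angle `φ ∈ [0, π]` from the positive axis:
position `ρ(cos φ · e_z + sin φ · e_r(θ)) = meridionalPoint θ (ρ sin φ) (ρ cos φ)`, velocity
`ρ(−sin φ · e_z + cos φ · e_r(θ)) = meridionalPoint θ (ρ cos φ) (−ρ sin φ)`. It runs from the
north pole `(0, 0, ρ)` through `r > 0` to the south pole `(0, 0, −ρ)`; as an interval integral it
is `0` (junk) when the integrand is not integrable on `[0, π]` (Majda–Bertozzi 2002, (1.57):
`∮_C v · dl = ∫ ⟪v(C(s)), C'(s)⟫ ds`). [cite: MajdaBertozziCUP2002, (1.57)] -/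
def meridionalArcIntegral (v : ℝ³ → ℝ³) (θ ρ : ℝ) : ℝ :=
  ∫ φ in (0 : ℝ)..π, ⟪v (meridionalPoint θ (ρ * Real.sin φ) (ρ * Real.cos φ)),
    meridionalPoint θ (ρ * Real.cos φ) (-(ρ * Real.sin φ))⟫

/-- The line integral `∫ v · dl = ∫ₛᵗ v₂(0, 0, z) dz` of `v` along the **axis segment** from
`(0, 0, s)` to `(0, 0, t)` (an oriented interval integral: swapping `s` and `t` changes the sign,
`axialSegmentIntegral_symm`). [cite: MajdaBertozziCUP2002, (1.57)] -/
def axialSegmentIntegral (v : ℝ³ → ℝ³) (s t : ℝ) : ℝ :=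
  ∫ z in s..t, v (axialPoint z) 2

/-- The **sectional circulation** of `v : ℝ³ → ℝ³` through the meridional half-annulus
`A(θ, a, b) = {y ∈ H_θ : a ≤ |y| ≤ b}`: the circulation `∮ v · dl` around `∂A(θ, a, b)` oriented
by the normal `n_θ = (−sin θ, cos θ, 0)`, as the sum of four line integrals — outer semicircle
`(0,0,b) → (0,0,−b)` through `r > 0`, axis `(0,0,−b) → (0,0,−a)`, inner semicircle backwards
`(0,0,−a) → (0,0,a)`, axis `(0,0,a) → (0,0,b)`. For `C¹` fields this is the flux
`∫_{A(θ,a,b)} ⟪curl v, n_θ⟫` by Stokes' theorem (Majda–Bertozzi 2002, (1.57), (1.61)); the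
reversed enumeration of the same four pieces is `−sectionalCirculation v θ a b` (module
docstring, "Orientation convention"). Total in all arguments; intended regime `0 < a ≤ b` with
`v` continuous on `ℝ³ ∖ {0}`. It is the quantity in which the per-generation circulation ledger
of an RDSS cascade is written (`sectionalCirculation_rdss_generation`; Brenner–Hormoz–Pumir
2016, §VI, eq. (19)). [folklore] -/
def sectionalCirculation (v : ℝ³ → ℝ³) (θ a b : ℝ) : ℝ :=
  meridionalArcIntegral v θ b + axialSegmentIntegral v (-b) (-a) - meridionalArcIntegral v θ a +
    axialSegmentIntegral v a b

/-- The sectional circulation, unfolded into its four interval integrals. [folklore] -/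
theorem sectionalCirculation_eq (v : ℝ³ → ℝ³) (θ a b : ℝ) :
    sectionalCirculation v θ a b =
      (∫ φ in (0 : ℝ)..π, ⟪v (meridionalPoint θ (b * Real.sin φ) (b * Real.cos φ)),
          meridionalPoint θ (b * Real.cos φ) (-(b * Real.sin φ))⟫) +
      (∫ z in (-b)..(-a), v (axialPoint z) 2) -
      (∫ φ in (0 : ℝ)..π, ⟪v (meridionalPoint θ (a * Real.sin φ) (a * Real.cos φ)),
          meridionalPoint θ (a * Real.cos φ) (-(a * Real.sin φ))⟫) +
      ∫ z in a..b, v (axialPoint z) 2 :=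
  rfl

/-! ### Degenerate sections, reversal, additivity in the radii -/

/-- A degenerate axis segment carries no circulation. [folklore] -/
@[simp] theorem axialSegmentIntegral_self (v : ℝ³ → ℝ³) (s : ℝ) :
    axialSegmentIntegral v s s = 0 :=
  integral_same

/-- Reversing an axis segment changes the sign of the line integral. [folklore] -/
theorem axialSegmentIntegral_symm (v : ℝ³ → ℝ³) (s t : ℝ) :
    axialSegmentIntegral v t s = -axialSegmentIntegral v s t :=
  integral_symm s t

/-- The degenerate half-annulus `a = b` carries no circulation. [folklore] -/
@[simp] theorem sectionalCirculation_self (v : ℝ³ → ℝ³) (θ a : ℝ) :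
    sectionalCirculation v θ a a = 0 := by
  simp [sectionalCirculation]

/-- Swapping the radii reverses the loop: `S v θ b a = −S v θ a b`. [folklore] -/
theorem sectionalCirculation_symm (v : ℝ³ → ℝ³) (θ a b : ℝ) :
    sectionalCirculation v θ b a = -sectionalCirculation v θ a b := by
  simp only [sectionalCirculation, axialSegmentIntegral_symm v (-b) (-a),
    axialSegmentIntegral_symm v a b]
  ring

/-- **Additivity in the radii** (the shells telescope): `S v θ a b + S v θ b c = S v θ a c` —
the common semicircle `|y| = b` is run once in each direction and the axis segments concatenate —
provided the axial integrand `z ↦ v₂(0,0,z)` is interval integrable on the four axis segments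
involved (automatic for `v` continuous off the origin and `a, b, c` of one sign,
`sectionalCirculation_add_of_continuousOn`). [folklore] -/
theorem sectionalCirculation_add (v : ℝ³ → ℝ³) (θ : ℝ) {a b c : ℝ}
    (hab : IntervalIntegrable (fun z => v (axialPoint z) 2) volume a b)
    (hbc : IntervalIntegrable (fun z => v (axialPoint z) 2) volume b c)
    (hab' : IntervalIntegrable (fun z => v (axialPoint z) 2) volume (-b) (-a))
    (hbc' : IntervalIntegrable (fun z => v (axialPoint z) 2) volume (-c) (-b)) :
    sectionalCirculation v θ a b + sectionalCirculation v θ b c =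
      sectionalCirculation v θ a c := by
  simp only [sectionalCirculation, axialSegmentIntegral]
  rw [← integral_add_adjacent_intervals hab hbc, ← integral_add_adjacent_intervals hbc' hab']
  ring

/-- For a field continuous off the origin the axial integrand is interval integrable on every
axis segment not containing the origin. [folklore] -/
theorem intervalIntegrable_axial_of_continuousOn {v : ℝ³ → ℝ³} (hv : ContinuousOn v {0}ᶜ)
    {s t : ℝ} (hst : (0 < s ∧ 0 < t) ∨ (s < 0 ∧ t < 0)) :
    IntervalIntegrable (fun z => v (axialPoint z) 2) volume s t := by
  refine ContinuousOn.intervalIntegrable ?_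
  have h0 : ∀ z ∈ uIcc s t, z ≠ 0 := by
    intro z hz
    rw [mem_uIcc] at hz
    rcases hst with ⟨hs, ht⟩ | ⟨hs, ht⟩
    · rcases hz with h | h
      · exact (hs.trans_le h.1).ne'
      · exact (ht.trans_le h.1).ne'
    · rcases hz with h | h
      · exact (h.2.trans_lt ht).ne
      · exact (h.2.trans_lt hs).ne
  have hcomp : ContinuousOn (fun z => v (axialPoint z)) (uIcc s t) :=
    hv.comp continuous_axialPoint.continuousOn fun z hz => axialPoint_ne_zero (h0 z hz)
  have h2 : Continuous fun p : ℝ³ => p 2 := by fun_prop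
  exact h2.comp_continuousOn hcomp

/-- Additivity in the radii for fields continuous off the origin and radii of one sign
(`0 < a, b, c`), the regime of the circulation ledger. [folklore] -/
theorem sectionalCirculation_add_of_continuousOn {v : ℝ³ → ℝ³} (hv : ContinuousOn v {0}ᶜ)
    (θ : ℝ) {a b c : ℝ} (ha : 0 < a) (hb : 0 < b) (hc : 0 < c) :
    sectionalCirculation v θ a b + sectionalCirculation v θ b c =
      sectionalCirculation v θ a c :=
  sectionalCirculation_add v θ (intervalIntegrable_axial_of_continuousOn hv (Or.inl ⟨ha, hb⟩))
    (intervalIntegrable_axial_of_continuousOn hv (Or.inl ⟨hb, hc⟩))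
    (intervalIntegrable_axial_of_continuousOn hv (Or.inr ⟨neg_lt_zero.2 hb, neg_lt_zero.2 ha⟩))
    (intervalIntegrable_axial_of_continuousOn hv (Or.inr ⟨neg_lt_zero.2 hc, neg_lt_zero.2 hb⟩))

/-- The sectional circulation is `2π`-periodic in the angle (`H_{θ+2π} = H_θ`). [folklore] -/
theorem sectionalCirculation_add_two_pi (v : ℝ³ → ℝ³) (θ a b : ℝ) :
    sectionalCirculation v (θ + 2 * π) a b = sectionalCirculation v θ a b := by
  simp only [sectionalCirculation, meridionalArcIntegral, meridionalPoint_add_two_pi]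

/-! ### Rotation covariance -/

/-- Conjugating the field by the rotation `rotZ α` turns the meridional arcs:
`∫_{arc(θ,ρ)} (R₋α ∘ v ∘ R_α) · dl = ∫_{arc(θ+α,ρ)} v · dl`. [folklore] -/
theorem meridionalArcIntegral_conj_rotZ (v : ℝ³ → ℝ³) (α θ ρ : ℝ) :
    meridionalArcIntegral (fun x => rotZ (-α) (v (rotZ α x))) θ ρ =
      meridionalArcIntegral v (θ + α) ρ := by
  simp only [meridionalArcIntegral, rotZ_meridionalPoint, inner_rotZ_neg_left]

/-- Conjugating the field by a rotation about the axis does not change the axial line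
integrals. [folklore] -/
theorem axialSegmentIntegral_conj_rotZ (v : ℝ³ → ℝ³) (α s t : ℝ) :
    axialSegmentIntegral (fun x => rotZ (-α) (v (rotZ α x))) s t =
      axialSegmentIntegral v s t := by
  simp only [axialSegmentIntegral, rotZ_axialPoint, rotZ_apply_two]

/-- **Rotation covariance.** For the rotation `R_α = rotZ α` about the axis,
`S (R₋α ∘ v ∘ R_α) θ a b = S v (θ + α) a b`: the sectional circulation of the conjugated field
through `H_θ` is that of `v` through the turned half-plane `R_α H_θ = H_{θ+α}`. [folklore] -/
theorem sectionalCirculation_conj_rotZ (v : ℝ³ → ℝ³) (α θ a b : ℝ) :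
    sectionalCirculation (fun x => rotZ (-α) (v (rotZ α x))) θ a b =
      sectionalCirculation v (θ + α) a b := by
  simp only [sectionalCirculation, meridionalArcIntegral_conj_rotZ,
    axialSegmentIntegral_conj_rotZ]

/-- For an **axisymmetric** field (`v ∘ R_θ = R_θ ∘ v`, `IsAxisymmetric`) the sectional
circulation does not depend on the meridional half-plane. [folklore] -/
theorem IsAxisymmetric.sectionalCirculation_eq {v : ℝ³ → ℝ³} (hv : IsAxisymmetric v)
    (θ a b : ℝ) : sectionalCirculation v θ a b = sectionalCirculation v 0 a b := by
  have h : (fun x => rotZ (-θ) (v (rotZ θ x))) = v := by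
    funext x
    rw [hv θ x, ← rotZ_add, neg_add_cancel, rotZ_zero]
  have := sectionalCirculation_conj_rotZ v θ 0 a b
  rw [h, zero_add] at this
  exact this.symm

/-- A linear isometry pinned by the coordinates of the quarter-turn about the axis,
`(Rx)₀ = −x₁, (Rx)₁ = x₀, (Rx)₂ = x₂` (the `R` of route `QuarterTurnRdss`), is `rotZ (π/2)`
(Bradshaw–Tsai 2017, §1, `R(s)` at `s = π/2`). [cite: BradshawTsai2017CPDE, §1] -/
theorem eq_rotZ_of_quarterTurn (R : ℝ³ ≃ₗᵢ[ℝ] ℝ³)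
    (hR : ∀ x : ℝ³, (R x) 0 = -(x 1) ∧ (R x) 1 = x 0 ∧ (R x) 2 = x 2) (x : ℝ³) :
    R x = rotZ (π / 2) x := by
  ext i
  fin_cases i
  · simp [(hR x).1]
  · simp [(hR x).2.1]
  · simp [(hR x).2.2]

/-- The inverse of the coordinate-pinned quarter-turn is `rotZ (−π/2)`. [folklore] -/
theorem symm_eq_rotZ_of_quarterTurn (R : ℝ³ ≃ₗᵢ[ℝ] ℝ³)
    (hR : ∀ x : ℝ³, (R x) 0 = -(x 1) ∧ (R x) 1 = x 0 ∧ (R x) 2 = x 2) (x : ℝ³) :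
    R.symm x = rotZ (-(π / 2)) x := by
  apply R.injective
  rw [R.apply_symm_apply, eq_rotZ_of_quarterTurn R hR, ← rotZ_add, add_neg_cancel, rotZ_zero]

/-- **Quarter-turn covariance** (requested form): for any linear isometry `R` with
`(Rx)₀ = −x₁, (Rx)₁ = x₀, (Rx)₂ = x₂`,
`sectionalCirculation (R⁻¹ ∘ v ∘ R) θ a b = sectionalCirculation v (θ + π/2) a b`. [folklore] -/
theorem sectionalCirculation_quarterTurn (R : ℝ³ ≃ₗᵢ[ℝ] ℝ³)
    (hR : ∀ x : ℝ³, (R x) 0 = -(x 1) ∧ (R x) 1 = x 0 ∧ (R x) 2 = x 2) (v : ℝ³ → ℝ³)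
    (θ a b : ℝ) :
    sectionalCirculation (fun x => R.symm (v (R x))) θ a b =
      sectionalCirculation v (θ + π / 2) a b := by
  simp only [eq_rotZ_of_quarterTurn R hR, symm_eq_rotZ_of_quarterTurn R hR]
  exact sectionalCirculation_conj_rotZ v (π / 2) θ a b

/-! ### Scaling covariance -/

/-- The Navier–Stokes rescaling `x ↦ c v(c x)` of the field rescales the meridional arcs:
`∫_{arc(θ,ρ)} (c v(c ·)) · dl = ∫_{arc(θ,cρ)} v · dl`, for every `c : ℝ`. [folklore] -/
theorem meridionalArcIntegral_nsRescaleData (v : ℝ³ → ℝ³) (c θ ρ : ℝ) :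
    meridionalArcIntegral (nsRescaleData c v) θ ρ = meridionalArcIntegral v θ (c * ρ) := by
  unfold meridionalArcIntegral nsRescaleData
  congr 1
  funext φ
  rw [smul_meridionalPoint, real_inner_smul_left, ← real_inner_smul_right, smul_meridionalPoint]
  simp only [mul_assoc, mul_neg]

/-- The rescaling `x ↦ c v(c x)` rescales the axis segments:
`∫ₛᵗ c v₂(0,0,cz) dz = ∫_{cs}^{ct} v₂(0,0,z) dz`, for every `c : ℝ` (for `c = 0` both sides
vanish). [folklore] -/
theorem axialSegmentIntegral_nsRescaleData (v : ℝ³ → ℝ³) (c s t : ℝ) :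
    axialSegmentIntegral (nsRescaleData c v) s t = axialSegmentIntegral v (c * s) (c * t) := by
  simp only [axialSegmentIntegral, nsRescaleData, smul_axialPoint, PiLp.smul_apply, smul_eq_mul]
  rw [intervalIntegral.integral_const_mul]
  exact intervalIntegral.smul_integral_comp_mul_left (fun z => v (axialPoint z) 2) c

/-- **Scaling covariance.** Circulation is dimensionless under the Navier–Stokes scaling
`nsRescaleData c v = (x ↦ c v(c x))`: `S (nsRescaleData c v) θ a b = S v θ (ca) (cb)` for every
`c : ℝ` (no positivity needed; for `c = 0` both sides vanish). [folklore] -/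
theorem sectionalCirculation_nsRescaleData (v : ℝ³ → ℝ³) (c θ a b : ℝ) :
    sectionalCirculation (nsRescaleData c v) θ a b =
      sectionalCirculation v θ (c * a) (c * b) := by
  simp only [sectionalCirculation, meridionalArcIntegral_nsRescaleData,
    axialSegmentIntegral_nsRescaleData, mul_neg]

/-- Scaling covariance, with the rescaled field written out as `x ↦ c • v (c • x)`. [folklore] -/
theorem sectionalCirculation_smul_comp_smul (v : ℝ³ → ℝ³) (c θ a b : ℝ) :
    sectionalCirculation (fun x => c • v (c • x)) θ a b =
      sectionalCirculation v θ (c * a) (c * b) :=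
  sectionalCirculation_nsRescaleData v c θ a b

/-! ### The circulation ledger of a rotated discretely self-similar datum -/

/-- **RDSS-homogeneous data.** If `u₀ = c R⁻¹ u₀(c R ·)` for the coordinate-pinned quarter-turn
`R` — the `(c, R)`-rotated discrete self-similarity of a datum (Bradshaw–Tsai 2017, §1,
(v0-RDSS), with phase `π/2`) — then `S u₀ θ a b = S u₀ (θ + π/2) (ca) (cb)`: the sectional
circulation through a shell equals that through the `c`-times larger shell a quarter turn
further. [cite: BradshawTsai2017CPDE, §1 (v0-RDSS)] -/
theorem sectionalCirculation_of_rdssHomogeneous {c : ℝ} (R : ℝ³ ≃ₗᵢ[ℝ] ℝ³)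
    (hR : ∀ x : ℝ³, (R x) 0 = -(x 1) ∧ (R x) 1 = x 0 ∧ (R x) 2 = x 2) {u₀ : ℝ³ → ℝ³}
    (h : ∀ x, c • R.symm (u₀ (c • R x)) = u₀ x) (θ a b : ℝ) :
    sectionalCirculation u₀ θ a b = sectionalCirculation u₀ (θ + π / 2) (c * a) (c * b) := by
  have hu : u₀ = nsRescaleData c (fun x => R.symm (u₀ (R x))) := by
    funext x
    simp only [nsRescaleData, LinearIsometryEquiv.map_smul]
    exact (h x).symm
  conv_lhs => rw [hu]
  rw [sectionalCirculation_nsRescaleData, sectionalCirculation_quarterTurn R hR]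

/-- **The per-generation circulation ledger.** For a `(c, R)`-RDSS-homogeneous datum
`u₀ = c R⁻¹ u₀(c R ·)` (`c ≠ 0`, `R` the quarter-turn) put
`Γ(θ, n) := sectionalCirculation u₀ θ c^{-(n+1)} c^{-n}`, the sectional circulation through the
`n`-th generation shell `c^{-(n+1)} ≤ |y| ≤ c^{-n}` of `H_θ` (`n : ℤ`). Then
`Γ(θ, n + 1) = Γ(θ + π/2, n)`: every generation of an exact quarter-turn RDSS cascade carries
the same sectional circulations, turned by a quarter turn — in contrast with the transfer
`Γₙ₊₁ = C Γₙ bₙ/aₙ` of the iterated cascade (Brenner–Hormoz–Pumir 2016, §VI, eq. (19)).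
[folklore] -/
theorem sectionalCirculation_rdss_generation {c : ℝ} (hc : c ≠ 0) (R : ℝ³ ≃ₗᵢ[ℝ] ℝ³)
    (hR : ∀ x : ℝ³, (R x) 0 = -(x 1) ∧ (R x) 1 = x 0 ∧ (R x) 2 = x 2) {u₀ : ℝ³ → ℝ³}
    (h : ∀ x, c • R.symm (u₀ (c • R x)) = u₀ x) (θ : ℝ) (n : ℤ) :
    sectionalCirculation u₀ θ (c ^ (-(n + 1 + 1))) (c ^ (-(n + 1))) =
      sectionalCirculation u₀ (θ + π / 2) (c ^ (-(n + 1))) (c ^ (-n)) := by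
  have h1 : c * c ^ (-(n + 1 + 1)) = c ^ (-(n + 1)) := by
    rw [show -(n + 1) = -(n + 1 + 1) + 1 by ring, zpow_add_one₀ hc, mul_comm]
  have h2 : c * c ^ (-(n + 1)) = c ^ (-n) := by
    rw [show -n = -(n + 1) + 1 by ring, zpow_add_one₀ hc, mul_comm]
  rw [sectionalCirculation_of_rdssHomogeneous R hR h, h1, h2]

/-- The same for a field `u : ℝ → ℝ³ → ℝ³` that is `(c, R)`-rotated discretely self-similar
(`IsRotatedDSS`; Bradshaw–Tsai 2017, (v-RDSS)), read off at the slice `t = 0`, where the RDSS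
identity `c R⁻¹ u(c²t, cRx) = u(t, x)` is exactly the homogeneity of `u 0`. (For an ancient
solution on `t < 0` the slice `u 0` is meaningful only once identified with the final datum
`u(·, 0⁻)`; this lemma says nothing about that identification.) [folklore] -/
theorem IsRotatedDSS.sectionalCirculation_slice_zero {c : ℝ} {R : ℝ³ ≃ₗᵢ[ℝ] ℝ³}
    (hR : ∀ x : ℝ³, (R x) 0 = -(x 1) ∧ (R x) 1 = x 0 ∧ (R x) 2 = x 2)
    {u : ℝ → ℝ³ → ℝ³} (hu : IsRotatedDSS c R u) (θ a b : ℝ) :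
    sectionalCirculation (u 0) θ a b =
      sectionalCirculation (u 0) (θ + π / 2) (c * a) (c * b) :=
  sectionalCirculation_of_rdssHomogeneous R hR (fun x => by simpa using hu 0 x) θ a b

end Literature.Analysis.FluidPDE
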